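import Summits.FinalStateConjecture.FinalStateConjecture.Theorems.SwallowTheDatumSubdataDevelopmentsEmbedThm12
import Literature.Geometry.Lorentzian.CommonDevelopmentProperExtension
import Literature.Geometry.Lorentzian.CauchyDevelopmentGlobalHyperbolicityProofs

/-!
# Route SwallowTheDatum · item `SubdataDevelopmentsEmbed` (stmt-FinalStateConjecture-10053) —
# the item from the two registered named facts of the local theory

`…Thm12.lean` proves the item from (a) local geometric uniqueness
(`hawkingEllis_locallyUnique_vacuumDevelopment`, registered named fact), (b) Sbierski's same-data
Theorem 12 displayed as a hypothesis `h12`, and (c) three global-hyperbolicity properties of vacuum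
Cauchy developments displayed as `hGH`. Since then (b) has been registered as the named fact
`sbierski_commonDevelopment_lt_of_hasCorrespondingBoundaryPoints`
(`CommonDevelopmentProperExtension.lean`, verbatim the shape of `h12`) and (c) has become a theorem
of the tree (`hawkingEllis_cauchyDevelopment_causalCompact_closed_holds`,
`CauchyDevelopmentGlobalHyperbolicityProofs.lean`, over `CauchyDevelopment`). Hence:

* `SubdataDevelopmentsEmbed.hGH_holds` — (c) for vacuum Cauchy developments, from the `_holds`
  theorem applied to the underlying Cauchy development;
* `subdataDevelopmentsEmbed_of_locallyUnique_of_sbierski :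
    hawkingEllis_locallyUnique_vacuumDevelopment →
    sbierski_commonDevelopment_lt_of_hasCorrespondingBoundaryPoints → SubdataDevelopmentsEmbed` —
  **the item hinges on exactly these two registered facts** (both are inputs of the existence of the
  MGHD, `MGHDExistenceReduction.lean`; no local EXISTENCE statement and no chain bound enters, so
  this line is finer than `subdataDevelopmentsEmbed_of_choquetBruhatGeroch` of
  `…LocalisationHolds.lean`). Closing line, once both `_holds` theorems exist:
  `subdataDevelopmentsEmbed_of_locallyUnique_of_sbierski LU_holds T12_holds`.

Pure composition; no definition; no new named fact.
-/

noncomputable section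

open Function Set Filter Topology TopologicalSpace
open scoped Manifold ContDiff Topology

namespace Summit.FinalStateConjecture.FinalStateConjecture.Theorems

open Literature.Geometry.Lorentzian

namespace SubdataDevelopmentsEmbed

/-- **Global hyperbolicity of vacuum Cauchy developments, in the shape `hGH` of `…Thm12.lean`**:
compactness of `J⁻(x) ∩ J⁺(ι X)` and of `J⁺(x) ∩ J⁻(ι X)`, and closedness of the causal relation
`≤` — the theorem `hawkingEllis_cauchyDevelopment_causalCompact_closed_holds` applied to the
underlying Cauchy development. [cite: HawkingEllis1973CUP, §6.6, Prop. 6.6.6 and Prop. 6.6.3]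
[cite: ONeillSemiRiemannian1983, Ch. 14, Lemma 14.22] -/
theorem hGH_holds :
    ∀ (X : Type) [TopologicalSpace X] [ChartedSpace E3 X] [IsManifold (𝓡 3) ∞ X]
      [ConnectedSpace X] (D : InitialDataSet (𝓡 3) X) (𝒟 : VacuumCauchyDevelopment D),
      (∀ x : 𝒟.carrier, IsCompact (𝒟.metric.causalPast 𝒟.timeOrientation {x} ∩
        𝒟.metric.causalFuture 𝒟.timeOrientation (range 𝒟.embed))) ∧
      (∀ x : 𝒟.carrier, IsCompact (𝒟.metric.causalFuture 𝒟.timeOrientation {x} ∩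
        𝒟.metric.causalPast 𝒟.timeOrientation (range 𝒟.embed))) ∧
      (∀ (xs ys : ℕ → 𝒟.carrier) (x y : 𝒟.carrier), Tendsto xs atTop (𝓝 x) →
        Tendsto ys atTop (𝓝 y) →
        (∀ j, ys j ∈ 𝒟.metric.causalFuture 𝒟.timeOrientation {xs j}) →
        y ∈ 𝒟.metric.causalFuture 𝒟.timeOrientation {x}) :=
  fun X _ _ _ _ D 𝒟 ↦
    hawkingEllis_cauchyDevelopment_causalCompact_closed_holds X D 𝒟.toCauchyDevelopment

end SubdataDevelopmentsEmbed

/-- **`SubdataDevelopmentsEmbed` from the two registered named facts of the local theory**: local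
geometric uniqueness for the vacuum Einstein equations (Hawking–Ellis 1973, §7.5; Sbierski 2016,
Thm. 2.4 (ii)) and Sbierski's Theorem 12 (a common globally hyperbolic development with
corresponding boundary points is strictly extendable; 2016, §3.2). Composition of
`subdataDevelopmentsEmbed_of_locallyUnique_of_thm12` with the global-hyperbolicity theorem
`SubdataDevelopmentsEmbed.hGH_holds`. [cite: HawkingEllis1973CUP, §7.5–7.6, pp. 248–251]
[cite: Sbierski2016AHP, Thm. 2.4 (ii), §3.2 Thm. 12 and §3.3] -/
theorem subdataDevelopmentsEmbed_of_locallyUnique_of_sbierski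
    (h : hawkingEllis_locallyUnique_vacuumDevelopment)
    (h12 : sbierski_commonDevelopment_lt_of_hasCorrespondingBoundaryPoints) :
    Summit.FinalStateConjecture.FinalStateConjecture.Theses.SwallowTheDatum.SubdataDevelopmentsEmbed :=
  subdataDevelopmentsEmbed_of_locallyUnique_of_thm12 h h12 SubdataDevelopmentsEmbed.hGH_holds

end Summit.FinalStateConjecture.FinalStateConjecture.Theorems

end
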